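import Summits.BirchSwinnertonDyer.BirchSwinnertonDyer.Theorems.ClassRecordThreeCornerAtThreeTwinLowerSupplyDefs
import Summits.BirchSwinnertonDyer.BirchSwinnertonDyer.Theorems.ErratumRoadFiveEulerHalfNotRamTransport
import HarnessLib

/-!
# Route `ClassRecordThree` (rung K2@3), crux 5 `EulerHalvesAtThree` (item stmt-BirchSwinnertonDyer-19109, routes `ClassRecordThree` ∕
# `KolyvaginRoadThree`): the TWIN-LOWER SUPPLY with an INERT EXTRA SET `C` — from Friedberg–Hoffstein with inertness at `S ∪ C` and the
# X11a lower half, on X11b ∧ ¬(ram) pairs (cell `bsd-stepL`, seat `bsd-stepL-tam3-p1` g19, LINE OWNER of 19109;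
# `--supports stmt-BirchSwinnertonDyer-19109 --as helper`)

WHY. The budget-set cores p659752 (`…ShimuraInertSavingBudgetSetAnchor`, (ram) side) and p660279 (`…ShimuraInertSavingBudgetSetTwinLowerD`,
image-free on a SUPPLY) consume a frame with the multiplicative inert set `S` AND the extra additive set `C` INERT in `K`. On ¬(ram) pairs the
twist's `≥`-half cannot come from Skinner 2016 Thm. C (no (ram) witness); it comes, as in corner3-p2 g6 ∕ corner-p1 g17's twin-lower road, from the
X11a LOWER HALF at the twist (item 19064 read at `p`). THIS FILE is corner3-p2's constructor `fhTwinLowerSupplyAt_of_friedbergHoffstein_of_x11aLowerHalf`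
with the extra set `C`: the frame from bsd-idea-10's (F4)-type Friedberg–Hoffstein binder (inertness at `S ∪ C`), ¬(ram) transported to the twist by
`not_ram_twist_of_inertSet_of_extraSet` (er5-p1's `not_ram_twist_of_inertSet` with the `K`-splitting binder asked only off `S ∪ C` and the twist
assumed non-multiplicative at `C` — the (F5)-type local input), and the X11a lower half placed at the twist. Output = the `hTL` binder of p660279.

HONEST FRAMING: theorems only (no definition, no named fact, no `sorry`); CONDITIONAL on the (F4)-type and (F5)-type binders and on `hX11a` (item
19064 at `p`); nothing is asserted about any curve; no census label moves (T7); item 19109 is NOT closed. BSD is proved for no curve.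
Credit: corner3-p2 g6 ∕ corner-p1 g17 (the supply road), er5-p1 (the ¬(ram) transport), bsd-idea-10 (the Cartan frame).
References: [FriedbergHoffstein1995] Thm. B; [Skinner2016PacificMC] Thm. C (shape); [Miller2011LMS] Def. 1.1; [SilvermanAEC2009] VII.5 Prop. 5.1(b), X.5 Cor. 5.4.
-/

noncomputable section

open scoped Classical

open WeierstrassCurve NumberField IsDedekindDomain Literature.NumberTheory.EllipticCurves
  Rat.HeightOneSpectrum CongruenceSubgroup
  Literature.NumberTheory.EllipticCurves.ModularForms
  Literature.NumberTheory.EllipticCurves.Rank1Residual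
  Literature.NumberTheory.EllipticCurves.Rank1Residual.Typed
  Literature.NumberTheory.QuadraticFields.Quadratic
  Literature.NumberTheory.EllipticCurves.BarriosEtAl2025
  Literature.NumberTheory.Automorphic
  Summit.BirchSwinnertonDyer.Rank1Residual
  Summit.BirchSwinnertonDyer.Rank1Residual.X11b

-- the cell's Theorems namespace repeats the summit name (Summit.<Summit>.<Problem>), as in every sibling file
set_option linter.dupNamespace false

namespace Summit.BirchSwinnertonDyer.BirchSwinnertonDyer.Theorems

/-! ### §1. ¬(ram) passes to the twist, with an extra set off the splitting binder -/

/-- **A (ram) witness of the twist is a (ram) witness of `E` — with an extra set `C` of places exempted from the splitting hypothesis**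
(so ¬(ram) passes to the twist): `not_ram_twist_of_inertSet` (er5-p1) VERBATIM except that the `K`-splitting binder `hsplit` is asked only
off `S ∪ C`, and at the places of `C` the twist is assumed NOT multiplicative (`hCtwist`; at bsd-idea-10's Cartan places this is Tate's
algorithm: the unramified quadratic twist of a IV ∕ IV* fibre is IV ∕ IV*). A (ram) witness `ℓ` of `Wd` is multiplicative for `Wd`, hence
`ℓ ∉ C`, and the original two cases apply. [cite: SilvermanAEC2009, VII.5 Prop. 5.1(b), VII.1 Prop. 1.3(b) and X.5 Cor. 5.4] -/
theorem not_ram_twist_of_inertSet_of_extraSet (W : WeierstrassCurve ℚ) [W.IsElliptic] [W.IsGloballyMinimal]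
    (p : ℕ) [Fact p.Prime] (K : Type) [Field K] [NumberField K] (S : Finset ℕ)
    (hSin : ∀ ℓ ∈ S, ∃ _ : Fact ℓ.Prime, Mult W ℓ ∧
      ((ℓ ≠ 2 ∧ jacobiSym (NumberField.discr K) ℓ = -1) ∨ (ℓ = 2 ∧ NumberField.discr K % 8 = 5)))
    (C : Finset ℕ)
    (hsplit : ∀ (ℓ : ℕ) [Fact ℓ.Prime], ¬ W.HasGoodReductionAtPrime ℓ → ℓ ∉ S → ℓ ∉ C →
      IsSquare (algebraMap ℚ ℚ_[ℓ] (NumberField.discr K : ℚ)))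
    {Wd : WeierstrassCurve ℚ} [Wd.IsElliptic] [Wd.IsGloballyMinimal]
    (hCtwist : ∀ (q : ℕ) [Fact q.Prime], q ∈ C → ¬ Wd.HasMultiplicativeReductionAtPrime q)
    (hnram : ¬ Ram W p) (Cd : VariableChange ℚ)
    (hWd : Cd • W.quadraticTwist (NumberField.discr K : ℚ) = Wd) : ¬ Ram Wd p := by
  rintro ⟨ℓ, hℓ, hℓp, hmultd, hv⟩
  have hD0 : (NumberField.discr K : ℚ) ≠ 0 := by exact_mod_cast NumberField.discr_ne_zero K
  haveI : (W.quadraticTwist (NumberField.discr K : ℚ)).IsElliptic := W.isElliptic_quadraticTwist hD0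
  have hj : Wd.j = W.j := by
    have h1 : Wd.j = (Cd • W.quadraticTwist (NumberField.discr K : ℚ)).j := by subst hWd; rfl
    rw [h1, variableChange_j]
    exact W.j_quadraticTwist hD0
  have hbad : ¬ W.HasGoodReductionAtPrime ℓ := fun hgood ↦
    not_hasMultiplicativeReductionAtPrime_of_j_eq hj ℓ hgood hmultd
  have hℓC : ℓ ∉ C := fun h ↦ hCtwist ℓ h hmultd
  by_cases hℓS : ℓ ∈ S
  · -- inert: the twist is unramified at `ℓ`
    obtain ⟨_, hm, hcase⟩ := hSin ℓ hℓS
    refine hnram ⟨ℓ, hℓ, hℓp, hm, ?_⟩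
    rcases hcase with ⟨hℓ2, hJ⟩ | ⟨hℓeq, h8⟩
    · rwa [← padicValInt_minimalDiscriminantInt_twist_eq_of_jacobiSym W K Cd hWd ℓ hℓ2 hJ]
    · subst hℓeq
      rwa [← padicValInt_minimalDiscriminantInt_twist_eq_of_mod_eight W K Cd hWd h8]
  · -- split: `d_K ∈ ℚ_ℓ^{×2}`
    have hsq := hsplit ℓ hbad hℓS hℓC
    refine hnram ⟨ℓ, hℓ, hℓp, ?_, ?_⟩
    · have h := hmultd
      rw [← hWd, hasMultiplicativeReductionAtPrime_smul_iff,
        hasMultiplicativeReductionAtPrime_quadraticTwist_iff W hD0 hsq] at h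
      exact h
    · rw [← padicValInt_minimalDiscriminantInt_twist_eq W ℓ hD0 hsq Cd hWd]
      exact hv

/-! ### §2. The supply with `T ∪ C` inert, from (F4) and the X11a lower half -/

/-- **The TWIN-LOWER SUPPLY with an INERT EXTRA SET `C` ⟸ Friedberg–Hoffstein with inertness at `S ∪ C` ∧ the X11a lower half at `p`, on an
X11b pair with no (ram) prime** (`p` odd, `ρ̄_{E,p}` irreducible, onto or not). At the (F4)-frame (`|d_K| > 4`, `T ∪ C` inert, the other bad primes
split, `L(E^{d_K},1) ≠ 0`) a global minimal model of the twist is a rank-`0` X11a pair at `p` (multiplicative at `p` — `p ∈ T` inert: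
`mult_twist_of_jacobiSym`; `p ∉ T`: `p ∉ C` as `C` is additive, so `d_K ∈ ℚ_p^{×2}` —, `E^{d}[p]` irreducible, no (ram) prime by
`not_ram_twist_of_inertSet_of_extraSet`), so `hX11a` applies and `exists_printShape_lower_of_missingLowerBoundAt_rankZero` puts its conclusion in the
displayed shape. = corner3-p2 g6's `fhTwinLowerSupplyAt_of_friedbergHoffstein_of_x11aLowerHalf` with `C`; the output is the `hTL` binder of p660279.
CONDITIONAL on `hGZK`, `hmod`, `hnf`, `hFHC`, `hCtwist`, `hX11a`. [cite: FriedbergHoffstein1995, Thm. B] [cite: Skinner2016PacificMC, Thm. C (shape)]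
[cite: Miller2011LMS, Def. 1.1] -/
theorem fhTwinLowerSupplyExtraSet_of_friedbergHoffsteinExtraSet_of_x11aLowerHalf
    (hGZK : rank_eq_analyticRank_of_analyticRank_le_one) (hmod : hasEntireLFunction_rat)
    (hnf : exists_isNewformOf)
    -- (F4)-type frame fact: Friedberg–Hoffstein with inertness prescribed at `S ∪ C` (bsd-idea-10's text VERBATIM, as a binder)
    (hFHC : ∀ (W : WeierstrassCurve ℚ) [W.IsElliptic], W.rootNumber = -1 →
      ∀ (S C : Finset ℕ), (∀ ℓ ∈ S, ∃ _ : Fact ℓ.Prime, W.HasMultiplicativeReductionAtPrime ℓ) →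
        Even S.card →
        (∀ q ∈ C, ∃ _ : Fact q.Prime, q ^ 2 ∣ W.conductorNorm ℤ ∧ ¬ q ^ 3 ∣ W.conductorNorm ℤ) →
      ∀ B : ℕ, ∃ (K : Type) (_ : Field K) (_ : NumberField K),
        IsImaginaryQuadratic K ∧ B < (NumberField.discr K).natAbs ∧
          (∀ ℓ ∈ S ∪ C, ((Ideal.span {(ℓ : ℤ)}).primesOver (𝓞 K)).ncard = 1 ∧
            ¬ (ℓ : ℤ) ∣ NumberField.discr K) ∧
          (∀ ℓ : ℕ, ℓ.Prime → ℓ ∣ W.conductorNorm ℤ → ℓ ∉ S → ℓ ∉ C →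
            ((Ideal.span {(ℓ : ℤ)}).primesOver (𝓞 K)).ncard = 2) ∧
          (W.quadraticTwist (NumberField.discr K : ℚ)).entireLFunction 1 ≠ 0)
    (W : WeierstrassCurve ℚ) [W.IsElliptic] [W.IsGloballyMinimal] (p : ℕ) [Fact p.Prime]
    (hX : ClassX11b W p) (hnram : ¬ Ram W p)
    -- the extra set: places with `q² ∥ N` (additive), at which NO twist by an imaginary quadratic `d_K` unramified and inert at `q` is
    -- multiplicative (the (F5)-type local input: an unramified quadratic twist of a IV ∕ IV* fibre is IV ∕ IV*; cite-only)
    (C : Finset ℕ)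
    (hCsq : ∀ q ∈ C, ∃ _ : Fact q.Prime, q ^ 2 ∣ W.conductorNorm ℤ ∧ ¬ q ^ 3 ∣ W.conductorNorm ℤ)
    (hCtwist : ∀ (K : Type) [Field K] [NumberField K], IsImaginaryQuadratic K →
      (∀ q ∈ C, ((Ideal.span {(q : ℤ)}).primesOver (𝓞 K)).ncard = 1 ∧ ¬ (q : ℤ) ∣ NumberField.discr K) →
      ∀ (Cd : VariableChange ℚ) (Wd : WeierstrassCurve ℚ) [Wd.IsElliptic] [Wd.IsGloballyMinimal],
        Cd • W.quadraticTwist (NumberField.discr K : ℚ) = Wd →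
        ∀ (q : ℕ) [Fact q.Prime], q ∈ C → ¬ Wd.HasMultiplicativeReductionAtPrime q)
    (hX11a : ∀ (Wd : WeierstrassCurve ℚ) [Wd.IsElliptic] [Wd.IsGloballyMinimal],
      ClassX11a Wd p → Typed.MissingLowerBoundAt Wd p) :
    ∀ (T : Finset ℕ), (∀ ℓ ∈ T, ∃ _ : Fact ℓ.Prime, Mult W ℓ) → Even T.card →
      ∃ (K : Type) (_ : Field K) (_ : NumberField K)
        (Wd : WeierstrassCurve ℚ) (_ : Wd.IsElliptic) (_ : Wd.IsGloballyMinimal) (Cd : VariableChange ℚ),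
        IsImaginaryQuadratic K ∧ 4 < (NumberField.discr K).natAbs ∧
        (∀ ℓ ∈ T ∪ C, ((Ideal.span {(ℓ : ℤ)}).primesOver (𝓞 K)).ncard = 1 ∧ ¬ (ℓ : ℤ) ∣ NumberField.discr K) ∧
        (∀ ℓ : ℕ, ℓ.Prime → ℓ ∣ W.conductorNorm ℤ → ℓ ∉ T → ℓ ∉ C →
          ((Ideal.span {(ℓ : ℤ)}).primesOver (𝓞 K)).ncard = 2) ∧
        (W.quadraticTwist (NumberField.discr K : ℚ)).entireLFunction 1 ≠ 0 ∧
        Cd • W.quadraticTwist (NumberField.discr K : ℚ) = Wd ∧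
        ∃ q : ℚ, Wd.entireLFunction 1 / (Wd.realPeriodRat : ℂ) = (q : ℂ) ∧
          padicValRat p q ≤ (padicValNat p Wd.shaOrder : ℤ) + padicValNat p Wd.tamagawaProduct -
            2 * padicValNat p Wd.torsionOrder := by
  intro T hTmult hTeven
  have hp : p.Prime := Fact.out
  obtain ⟨hr, hp2, hmult, hirr⟩ := id hX
  -- the sign of the functional equation is `−1` (modularity, `r_an = 1`)
  have hw : W.rootNumber = -1 := by
    rw [WeierstrassCurve.rootNumber_eq_neg_one_pow_analyticRank_of_exists_isNewformOf hnf W, hr]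
    norm_num
  -- the Friedberg–Hoffstein field, `T` inert, every other bad prime split, `|d_K| > 4`
  obtain ⟨K, _, _, hK, hdisc, hinertTC, hsplitN, hLt⟩ := hFHC W hw T C hTmult hTeven hCsq 4
  have h2 := hK.1
  have hinert : ∀ ℓ ∈ T, ((Ideal.span {(ℓ : ℤ)}).primesOver (𝓞 K)).ncard = 1 ∧ ¬ (ℓ : ℤ) ∣ NumberField.discr K :=
    fun ℓ hℓ ↦ hinertTC ℓ (Finset.mem_union_left C hℓ)
  have hinertC : ∀ q ∈ C, ((Ideal.span {(q : ℤ)}).primesOver (𝓞 K)).ncard = 1 ∧ ¬ (q : ℤ) ∣ NumberField.discr K :=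
    fun q hq ↦ hinertTC q (Finset.mem_union_right T hq)
  -- the places of `C` are additive for `E` (`q² ∣ N`): not multiplicative, in particular `p ∉ C`
  have hnotMultC : ∀ (q : ℕ) [Fact q.Prime], q ∈ C → ¬ W.HasMultiplicativeReductionAtPrime q := by
    intro q hqF hq hm
    obtain ⟨_, h2', -⟩ := hCsq q hq
    exact not_sq_dvd_conductorNorm_of_mult W q hm h2'
  have hTin : ∀ ℓ ∈ T, ∃ _ : Fact ℓ.Prime, Mult W ℓ ∧
      ((ℓ ≠ 2 ∧ jacobiSym (NumberField.discr K) ℓ = -1) ∨ (ℓ = 2 ∧ NumberField.discr K % 8 = 5)) := by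
    intro ℓ hℓ
    obtain ⟨hℓF, hm⟩ := hTmult ℓ hℓ
    obtain ⟨hn, hd⟩ := hinert ℓ hℓ
    refine ⟨hℓF, hm, ?_⟩
    have hn' : ((Ideal.span {(ℓ : ℤ)}).primesOver (𝓞 K)).ncard ≠ 2 := by rw [hn]; decide
    by_cases hℓ2 : ℓ = 2
    · subst hℓ2
      have hn2 : ((Ideal.span {(2 : ℤ)}).primesOver (𝓞 K)).ncard ≠ 2 := by
        simpa only [Nat.cast_ofNat] using hn'
      have hd2 : ¬ (2 : ℤ) ∣ NumberField.discr K := by simpa only [Nat.cast_ofNat] using hd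
      exact Or.inr ⟨rfl, discr_emod_eight_eq_five_of_ncard_ne_two h2 hn2 hd2⟩
    · exact Or.inl ⟨hℓ2, jacobiSym_discr_eq_neg_one_of_ncard_ne_two h2 hℓF.out hℓ2 hn' hd⟩
  have hsplit : ∀ (ℓ : ℕ) [Fact ℓ.Prime], ¬ W.HasGoodReductionAtPrime ℓ → ℓ ∉ T → ℓ ∉ C →
      IsSquare (algebraMap ℚ ℚ_[ℓ] (NumberField.discr K : ℚ)) := by
    intro ℓ hℓF hg hℓT hℓC
    have hℓN : ℓ ∣ W.conductorNorm ℤ := (W.dvd_conductorNorm_iff_not_hasGoodReductionAtPrime ℓ).mpr hg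
    exact isSquare_discr_padic_of_ncard_eq_two h2 ℓ (hsplitN ℓ hℓF.out hℓN hℓT hℓC)
  -- a globally minimal model of the twist
  have hD0 : (NumberField.discr K : ℚ) ≠ 0 := by exact_mod_cast NumberField.discr_ne_zero K
  haveI hEt : (W.quadraticTwist (NumberField.discr K : ℚ)).IsElliptic :=
    W.isElliptic_quadraticTwist hD0
  obtain ⟨Cd, hCd⟩ := hasGlobalMinimalModel_rat_holds (W.quadraticTwist (NumberField.discr K : ℚ))
  haveI : (Cd • W.quadraticTwist (NumberField.discr K : ℚ)).IsGloballyMinimal := hCd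
  set Wd : WeierstrassCurve ℚ := Cd • W.quadraticTwist (NumberField.discr K : ℚ) with hWd_def
  have hWd : Cd • W.quadraticTwist (NumberField.discr K : ℚ) = Wd := rfl
  -- the twist has analytic rank `0` and `E^{d}[p]` irreducible
  have hirrd : Wd.HasIrreducibleModPGaloisRep p :=
    hasIrreducibleModPGaloisRep_twist_model W p K h2 hirr Cd hWd
  have hLt' : (W.quadraticTwist (NumberField.discr K : ℚ)).entireLFunction = Wd.entireLFunction := by
    rw [← hWd, entireLFunction_smul]
  have hLd1 : Wd.entireLFunction 1 ≠ 0 := by rw [← hLt']; exact hLt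
  have hrd : Wd.analyticRank = 0 := (Wd.analyticRank_eq_zero_iff_holds (hmod Wd)).2 hLd1
  -- the twist is an X11a pair at `p`: `p` inert (in `T`) or split (off `T`)
  have hXd : ClassX11a Wd p := by
    by_cases hpT : p ∈ T
    · obtain ⟨hnp, hdp⟩ := hinert p hpT
      have hJp : jacobiSym (NumberField.discr K) p = -1 :=
        jacobiSym_discr_eq_neg_one_of_ncard_ne_two h2 hp hp2 (by rw [hnp]; decide) hdp
      exact ⟨hrd, hp2, mult_twist_of_jacobiSym W K Cd hWd p hp2 hJp hmult, hirrd,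
        not_ram_twist_of_inertSet_of_extraSet W p K T hTin C (fun ℓ _ hg hℓT hℓC ↦ hsplit ℓ hg hℓT hℓC)
          (fun q _ hq ↦ hCtwist K hK hinertC Cd Wd hWd q hq) hnram Cd hWd⟩
    · have hmultd : Mult Wd p := by
        have hsq : IsSquare (algebraMap ℚ ℚ_[p] (NumberField.discr K : ℚ)) :=
          hsplit p (WeierstrassCurve.HasMultiplicativeReduction.not_hasGoodReduction (R := ℤ_[p]) hmult) hpT
            (fun hpC ↦ hnotMultC p hpC hmult)
        have h' : (Cd • W.quadraticTwist (NumberField.discr K : ℚ)).HasMultiplicativeReductionAtPrime p := by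
          rw [hasMultiplicativeReductionAtPrime_smul_iff]
          exact (hasMultiplicativeReductionAtPrime_quadraticTwist_iff W hD0 hsq).mpr hmult
        exact h'
      exact ⟨hrd, hp2, hmultd, hirrd,
        not_ram_twist_of_inertSet_of_extraSet W p K T hTin C (fun ℓ _ hg hℓT hℓC ↦ hsplit ℓ hg hℓT hℓC)
          (fun q _ hq ↦ hCtwist K hK hinertC Cd Wd hWd q hq) hnram Cd hWd⟩
  -- the X11a lower half at the twist, in print shape
  obtain ⟨qS, hqS, hvqS⟩ :=
    AdditivePotMult.exists_printShape_lower_of_missingLowerBoundAt_rankZero (p := p) Wd hGZK hrd hirrd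
      (hX11a Wd hXd)
  exact ⟨K, inferInstance, inferInstance, Wd, inferInstance, hCd, Cd, hK, hdisc, hinertTC, hsplitN, hLt, hWd,
    qS, hqS, hvqS⟩

end Summit.BirchSwinnertonDyer.BirchSwinnertonDyer.Theorems

end
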